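import Mathlib
import Summits.Ventures.HodgeRepro.Tier4.Target
import Summits.Ventures.HodgeRepro.Tier4.Line3.KMDatum
import Summits.Ventures.HodgeRepro.Tier4.Line3.KMDatumS
import Summits.Ventures.HodgeRepro.Tier4.Line3.Defs
import Summits.Ventures.HodgeRepro.Tier4.Line3.HeckeEquivarianceLemmas
import Summits.Ventures.HodgeRepro.Tier4.Line3.CoefInvariance
import Summits.Ventures.HodgeRepro.Tier4.Line3.TorusInvariance
import Summits.Ventures.HodgeRepro.Tier4.Line3.MainClassReps

/-!
# Tier4/Line3/ClassFibres — the `Γ′`-classes as orbits of `Γ′` and the stabiliser fibres (L3.6a, R2′)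

Blind re-derivation cell `pub-hodge-repro`, Tier 4 «PROVE THE STEP» (README §9–§10), LINE L3, seat t4-L3-p1 (prover);
support (R-a, R-b of proofs/t4/L3/L36a-support.md) of L3.6a `term_main_unfold` (lead S12253).

CONTENT.  `classStep K` is an equivalence relation (`Γ′` is a group, the torus is absorbed by the lines), so a line tuple
lies in the class of `lines x` iff it is `lines (γ • x)` for some `γ ∈ Γ′` (`exists_mem_of_classOf_eq`,
`classOf_lines_mulVec_mem`); in particular the class `c` of the main orbit is the image of `Γ′ → LineTuple`,
`γ ↦ lines (γ • mainRep K xm c)` (`mem_class_iff`).  The fibre of this map over `lines (γ₀ • x)` is the coset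
`γ₀ · Stab(x)` of the stabiliser `Stab(x) = {δ ∈ Γ′ // lines (δ • x) = lines x}` (`fibreEquivStab`), so all fibres have
`Nat.card = stabCard K x` (`natCard_fibre`) — the hypothesis of `FibreCount.tsum_comp_eq_card_smul_tsum` once `Stab(x)` is
finite (residual R-c, Kronecker).

Nothing here asserts anything about the truth of (P); HC_CM is NOT proved by anyone in this repository.
-/

set_option autoImplicit false

noncomputable section

namespace Summit.Ventures.HodgeRepro.Tier4.Line3

open Summit.Ventures.HodgeRepro.Tier4
open Matrix
open HeckeEquivariance

namespace T4Data

variable (X : T4Data)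

/-- One class step forward from `lines x`: `lines (γ • x)`. -/
theorem classStep_lines (K : X.Level) {γ : Matrix (Fin 3) (Fin 3) X.E} (hγ : γ ∈ K.1) (x : X.Tuple) :
    X.classStep K (X.lines x) (X.lines (fun j => γ *ᵥ x j)) := by
  obtain ⟨t, ht, hrep⟩ := X.exists_torus_rep_lines x
  refine ⟨γ, hγ, ?_⟩
  rw [hrep]
  have : (fun j => γ *ᵥ (t j • x j)) = fun j => t j • (γ *ᵥ x j) := funext fun j => Matrix.mulVec_smul _ _ _
  rw [this, X.lines_smul t ht]

/-- `lines (γ • x)` lies in the class of `lines x` for `γ ∈ Γ′`. -/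
theorem classOf_lines_mulVec_mem (K : X.Level) {γ : Matrix (Fin 3) (Fin 3) X.E} (hγ : γ ∈ K.1) (x : X.Tuple) :
    X.classOf K (X.lines (fun j => γ *ᵥ x j)) = X.classOf K (X.lines x) :=
  (Quot.sound (X.classStep_lines K hγ x)).symm

/-- One class step backwards: if `classStep K a b` and `b = lines x₂` then `a = lines (γ⁻¹ • x₂)` with `γ⁻¹ ∈ Γ′`. -/
theorem exists_mem_of_classStep_symm (K : X.Level) {a b : X.LineTuple} (hab : X.classStep K a b) (x₂ : X.Tuple)
    (hb : b = X.lines x₂) :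
    ∃ γ ∈ K.1, a = X.lines (fun j => γ *ᵥ x₂ j) := by
  obtain ⟨γ, hγ, hab'⟩ := hab
  obtain ⟨γ', hγ', hγγ', hγ'γ⟩ := exists_inv_mem K.2.1 hγ
  obtain ⟨t, ht, hx₂⟩ := X.exists_torus_of_lines_eq (hab'.symm.trans hb)
  refine ⟨γ', hγ', ?_⟩
  have hx₂' : x₂ = fun j => t j • (γ *ᵥ X.rep a j) := funext hx₂
  rw [hx₂']
  have : (fun j => γ' *ᵥ (t j • (γ *ᵥ X.rep a j))) = fun j => t j • X.rep a j := by
    funext j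
    rw [Matrix.mulVec_smul, Matrix.mulVec_mulVec, hγ'γ, Matrix.one_mulVec]
  rw [this, X.lines_smul t ht, X.lines_rep]

/-- **A LINE TUPLE IN THE CLASS OF `lines x` IS `lines (γ • x)` FOR SOME `γ ∈ Γ′`** (the class relation is an
equivalence relation). -/
theorem exists_mem_of_classOf_eq (K : X.Level) (x : X.Tuple) {w : X.LineTuple}
    (h : X.classOf K (X.lines x) = X.classOf K w) :
    ∃ γ ∈ K.1, w = X.lines (fun j => γ *ᵥ x j) := by
  have hgen := Quot.eqvGen_exact h
  have key : ∀ w₁ w₂ : X.LineTuple, Relation.EqvGen (X.classStep K) w₁ w₂ →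
      (∀ x₁ : X.Tuple, w₁ = X.lines x₁ → ∃ γ ∈ K.1, w₂ = X.lines (fun j => γ *ᵥ x₁ j)) ∧
      (∀ x₂ : X.Tuple, w₂ = X.lines x₂ → ∃ γ ∈ K.1, w₁ = X.lines (fun j => γ *ᵥ x₂ j)) := by
    intro w₁ w₂ hgen
    induction hgen with
    | rel a b hab =>
      refine ⟨fun x₁ hx₁ => ?_, fun x₂ hx₂ => X.exists_mem_of_classStep_symm K hab x₂ hx₂⟩
      subst hx₁
      obtain ⟨γ, hγ, hb⟩ := hab
      obtain ⟨t, ht, hrep⟩ := X.exists_torus_rep_lines x₁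
      refine ⟨γ, hγ, ?_⟩
      rw [hb, hrep]
      have : (fun j => γ *ᵥ (t j • x₁ j)) = fun j => t j • (γ *ᵥ x₁ j) := funext fun j => Matrix.mulVec_smul _ _ _
      rw [this, X.lines_smul t ht]
    | refl a =>
      refine ⟨fun x₁ hx₁ => ⟨1, K.2.1.1, ?_⟩, fun x₂ hx₂ => ⟨1, K.2.1.1, ?_⟩⟩
      · rw [hx₁]; simp [Matrix.one_mulVec]
      · rw [hx₂]; simp [Matrix.one_mulVec]
    | symm a b _ ih => exact ⟨ih.2, ih.1⟩
    | trans a b d _ _ ih₁ ih₂ =>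
      refine ⟨fun x₁ hx₁ => ?_, fun x₂ hx₂ => ?_⟩
      · obtain ⟨γ, hγ, hb⟩ := ih₁.1 x₁ hx₁
        obtain ⟨γ', hγ', hd⟩ := ih₂.1 (fun j => γ *ᵥ x₁ j) hb
        refine ⟨γ' * γ, K.2.1.2.1 γ' hγ' γ hγ, ?_⟩
        rw [hd]
        funext j
        simp [Matrix.mulVec_mulVec]
      · obtain ⟨γ', hγ', hb⟩ := ih₂.2 x₂ hx₂
        obtain ⟨γ, hγ, ha⟩ := ih₁.2 (fun j => γ' *ᵥ x₂ j) hb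
        refine ⟨γ * γ', K.2.1.2.1 γ hγ γ' hγ', ?_⟩
        rw [ha]
        funext j
        simp [Matrix.mulVec_mulVec]
  exact (key _ _ hgen).1 x rfl

/-- **THE CLASS OF THE MAIN ORBIT IS THE `Γ′`-ORBIT OF ITS REPRESENTATIVE**: `classOf K w = c ↔ ∃ γ ∈ Γ′, w = lines (γ • mainRep c)`. -/
theorem mem_class_iff (K : X.Level) (xm : X.Tuple) (c : X.MainClass K xm) (w : X.LineTuple) :
    X.classOf K w = c.1 ↔ ∃ γ ∈ K.1, w = X.lines (fun j => γ *ᵥ X.mainRep K xm c j) := by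
  constructor
  · intro h
    exact X.exists_mem_of_classOf_eq K (X.mainRep K xm c) ((X.classOf_lines_mainRep K xm c).trans h.symm)
  · rintro ⟨γ, hγ, rfl⟩
    rw [X.classOf_lines_mulVec_mem K hγ, X.classOf_lines_mainRep]

/-! ## The stabiliser fibres -/

/-- The stabiliser of the line tuple of `x` in `Γ′` (the type whose `Nat.card` is the skeleton's `stabCard K x`). -/
abbrev Stab (K : X.Level) (x : X.Tuple) : Type :=
  {γ : Matrix (Fin 3) (Fin 3) X.E // γ ∈ K.1 ∧ X.lines (fun j => γ *ᵥ x j) = X.lines x}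

/-- The orbit map `Γ′ → LineTuple`, `γ ↦ lines (γ • x)`. -/
def orbitMap (K : X.Level) (x : X.Tuple) (γ : {γ : Matrix (Fin 3) (Fin 3) X.E // γ ∈ K.1}) : X.LineTuple :=
  X.lines (fun j => γ.1 *ᵥ x j)

/-- **THE FIBRE OF THE ORBIT MAP over `lines (γ₀ • x)` IS THE COSET `γ₀ · Stab(x)`.** -/
def fibreEquivStab (K : X.Level) (x : X.Tuple) (γ₀ : {γ : Matrix (Fin 3) (Fin 3) X.E // γ ∈ K.1}) :
    {γ : {γ : Matrix (Fin 3) (Fin 3) X.E // γ ∈ K.1} // X.orbitMap K x γ = X.orbitMap K x γ₀} ≃ X.Stab K x where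
  toFun γ := ⟨γ₀.1⁻¹ * γ.1.1, by
    obtain ⟨γ₀', hγ₀', hγγ₀', hγ₀'γ⟩ := exists_inv_mem K.2.1 γ₀.2
    have hinv : γ₀.1⁻¹ = γ₀' := by
      have hd : IsUnit γ₀.1.det := (Matrix.isUnit_iff_isUnit_det _).mp ⟨⟨γ₀.1, γ₀', hγγ₀', hγ₀'γ⟩, rfl⟩
      calc γ₀.1⁻¹ = γ₀.1⁻¹ * (γ₀.1 * γ₀') := by rw [hγγ₀', Matrix.mul_one]
        _ = γ₀' := by rw [← Matrix.mul_assoc, Matrix.nonsing_inv_mul _ hd, Matrix.one_mul]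
    refine ⟨by rw [hinv]; exact K.2.1.2.1 γ₀' hγ₀' γ.1.1 γ.1.2, ?_⟩
    have h := γ.2
    unfold T4Data.orbitMap at h
    -- `lines (γ • x) = lines (γ₀ • x)` ⇒ `lines (γ₀⁻¹ γ • x) = lines x`
    have hx : (fun j => (γ₀.1⁻¹ * γ.1.1) *ᵥ x j) = fun j => γ₀.1⁻¹ *ᵥ (γ.1.1 *ᵥ x j) :=
      funext fun j => (Matrix.mulVec_mulVec _ _ _).symm
    rw [hx, hinv]
    obtain ⟨t, ht, hx'⟩ := X.exists_torus_of_lines_eq h.symm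
    have hx'' : (fun j => γ₀' *ᵥ (γ.1.1 *ᵥ x j)) = fun j => t j • x j := by
      funext j
      rw [hx' j, Matrix.mulVec_smul, Matrix.mulVec_mulVec, hγ₀'γ, Matrix.one_mulVec]
    rw [hx'', X.lines_smul t ht]⟩
  invFun δ := ⟨⟨γ₀.1 * δ.1, K.2.1.2.1 γ₀.1 γ₀.2 δ.1 δ.2.1⟩, by
    unfold T4Data.orbitMap
    have hx : (fun j => (γ₀.1 * δ.1) *ᵥ x j) = fun j => γ₀.1 *ᵥ (δ.1 *ᵥ x j) :=
      funext fun j => (Matrix.mulVec_mulVec _ _ _).symm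
    rw [hx]
    obtain ⟨t, ht, hx'⟩ := X.exists_torus_of_lines_eq δ.2.2.symm
    have hx'' : (fun j => γ₀.1 *ᵥ (δ.1 *ᵥ x j)) = fun j => t j • (γ₀.1 *ᵥ x j) := by
      funext j
      rw [hx' j, Matrix.mulVec_smul]
    rw [hx'', X.lines_smul t ht]⟩
  left_inv γ := by
    obtain ⟨γ₀', hγ₀', hγγ₀', hγ₀'γ⟩ := exists_inv_mem K.2.1 γ₀.2
    have hd : IsUnit γ₀.1.det := (Matrix.isUnit_iff_isUnit_det _).mp ⟨⟨γ₀.1, γ₀', hγγ₀', hγ₀'γ⟩, rfl⟩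
    apply Subtype.ext
    apply Subtype.ext
    show γ₀.1 * (γ₀.1⁻¹ * γ.1.1) = γ.1.1
    rw [← Matrix.mul_assoc, Matrix.mul_nonsing_inv _ hd, Matrix.one_mul]
  right_inv δ := by
    obtain ⟨γ₀', hγ₀', hγγ₀', hγ₀'γ⟩ := exists_inv_mem K.2.1 γ₀.2
    have hd : IsUnit γ₀.1.det := (Matrix.isUnit_iff_isUnit_det _).mp ⟨⟨γ₀.1, γ₀', hγγ₀', hγ₀'γ⟩, rfl⟩
    apply Subtype.ext
    show γ₀.1⁻¹ * (γ₀.1 * δ.1) = δ.1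
    rw [← Matrix.mul_assoc, Matrix.nonsing_inv_mul _ hd, Matrix.one_mul]

/-- Every fibre of the orbit map has `Nat.card = stabCard K x`. -/
theorem natCard_fibre (K : X.Level) (x : X.Tuple) (γ₀ : {γ : Matrix (Fin 3) (Fin 3) X.E // γ ∈ K.1}) :
    Nat.card {γ : {γ : Matrix (Fin 3) (Fin 3) X.E // γ ∈ K.1} // X.orbitMap K x γ = X.orbitMap K x γ₀} =
      X.stabCard K x :=
  Nat.card_congr (X.fibreEquivStab K x γ₀)

/-- Every fibre of the orbit map is finite when the stabiliser is. -/
theorem finite_fibre (K : X.Level) (x : X.Tuple) [Finite (X.Stab K x)]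
    (γ₀ : {γ : Matrix (Fin 3) (Fin 3) X.E // γ ∈ K.1}) :
    Finite {γ : {γ : Matrix (Fin 3) (Fin 3) X.E // γ ∈ K.1} // X.orbitMap K x γ = X.orbitMap K x γ₀} :=
  Finite.of_equiv _ (X.fibreEquivStab K x γ₀).symm

end T4Data

end Summit.Ventures.HodgeRepro.Tier4.Line3

end
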